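import Literature.Probability.Percolation.Percolation
import Literature.Barriers.CriticalPhenomena.SubexponentialGrowthZd
import Mathlib.GroupTheory.GroupAction.Basic
import HarnessLib

/-!
# Strict monotonicity of `p_c` under quotients by free group actions (Martineau–Severo 2019)

Topic `Literature/Probability/Percolation`. Named fact (no proof) from

* [MartineauSevero2019] S. Martineau, F. Severo, *Strict monotonicity of percolation thresholds
  under covering maps*, Ann. Probab. 47 (2019), arXiv:1803.09686 — Corollary 2.2 (the positive
  answer to Benjamini–Schramm's Question 1.1), read in the held text `paper:arxiv-1803.09686`
  (§1 for the quotient graph, §2 Cor. 2.2 for the statement, "Convention" for the standing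
  hypotheses: graphs non-empty, locally finite, connected, simple; Bernoulli BOND percolation).

It grounds item `SlabStrictSubcritical` of route
`CriticalPhenomena/PercolationContinuityZ3/PercDivergentSlabLadder` (strict subcriticality
`p_c(ℤ³) < p_c(C_k)` of every centred slab `C_k = {|z₀| ≤ k}` at the bulk critical point): take
`𝒢 = ℤ³` (`zdGraph 3`, quasi-transitive by
`Literature.Barriers.CriticalPhenomena.zdGraph_isQuasiTransitive`, `p_c(ℤ³) < 1`), `Γ = ℤ` acting
freely by `n • z = z + (2k+1) n e₀`; the quotient is the periodic slab `ℤ² × ℤ/(2k+1)ℤ`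
(transitive), of which `C_k` is a spanning subgraph, so `p_c(ℤ³) < p_c(ℤ² × ℤ/(2k+1)ℤ) ≤ p_c(C_k)`
(the last step by monotonicity of `θ` under deletion of edges). That bookkeeping (the graph
isomorphism of the abstract orbit quotient with the periodic slab, and the comparison with the
induced slab) is left to the prover; only the printed corollary is vendored here.

## Objects

* `orbitQuotientGraph G Γ` — the quotient graph `𝒢/Γ` of [MartineauSevero2019, §1]: "A vertex of
  the quotient graph `𝒢/G` is an orbit of `G ↷ V`, and two distinct orbits are connected by an edge
  if and only if there is an edge of `𝒢` intersecting both orbits" (a simple graph on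
  `MulAction.orbitRel.Quotient Γ V`).
* Quasi-transitivity is the tree's `Literature.Barriers.CriticalPhenomena.IsQuasiTransitive`
  (finitely many `Aut`-orbits); `p_c` is the tree's vertex-based `criticalProb G x` (for a connected
  graph it does not depend on `x`; the fact is stated at a vertex `x` and its orbit `⟦x⟧`).

## The fact

`MartineauSevero2019_cor22`: for a countable, locally finite, connected graph `𝒢`, a nontrivial
group `Γ` acting FREELY on `V(𝒢)` by graph automorphisms, with `𝒢` and `𝒢/Γ` quasi-transitive and
`p_c(𝒢) < 1`: `p_c(𝒢) < p_c(𝒢/Γ)`. (The weak inequality `p_c(𝒢) ≤ p_c(𝒢/Γ)` is Benjamini–Schramm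
1996, Thm 1, not vendored here.)
-/

namespace Literature.Probability.Percolation

open Literature.Barriers.CriticalPhenomena (IsQuasiTransitive)

variable {V : Type*}

/-- The **quotient graph** `𝒢/Γ` of a graph by a group acting on its vertices: vertices are the
`Γ`-orbits, and two DISTINCT orbits are adjacent iff some edge of `𝒢` meets both
[MartineauSevero2019, §1, "Setting of [BS96]"]. [cite: MartineauSevero2019, §1 (quotient graph 𝒢/G)] -/
def orbitQuotientGraph (G : SimpleGraph V) (Γ : Type*) [Group Γ] [MulAction Γ V] :
    SimpleGraph (MulAction.orbitRel.Quotient Γ V) :=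
  SimpleGraph.fromRel fun a b => ∃ x y : V,
    (Quotient.mk (MulAction.orbitRel Γ V) x) = a ∧ (Quotient.mk (MulAction.orbitRel Γ V) y) = b ∧
      G.Adj x y

/-- Adjacency in the quotient graph: distinct orbits met by a common edge (Mathlib's `fromRel`
symmetrises the already symmetric relation). [cite: MartineauSevero2019, §1 (quotient graph 𝒢/G)] -/
theorem orbitQuotientGraph_adj (G : SimpleGraph V) (Γ : Type*) [Group Γ] [MulAction Γ V]
    (a b : MulAction.orbitRel.Quotient Γ V) :
    (orbitQuotientGraph G Γ).Adj a b ↔ a ≠ b ∧ ∃ x y : V,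
      (Quotient.mk (MulAction.orbitRel Γ V) x) = a ∧ (Quotient.mk (MulAction.orbitRel Γ V) y) = b ∧
        G.Adj x y := by
  rw [orbitQuotientGraph, SimpleGraph.fromRel_adj]
  constructor
  · rintro ⟨hne, h | h⟩
    · exact ⟨hne, h⟩
    · obtain ⟨x, y, hx, hy, hxy⟩ := h
      exact ⟨hne, y, x, hy, hx, hxy.symm⟩
  · rintro ⟨hne, h⟩
    exact ⟨hne, Or.inl h⟩

/-- **Martineau–Severo 2019, Corollary 2.2 (strict monotonicity of `p_c` under quotients; answer
to Benjamini–Schramm's Question 1.1).** "Let `𝒢` be a graph. Let `G ≠ {1}` be a group acting on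
`V(𝒢)` by graph automorphisms, and let `ℋ` denote the quotient graph `𝒢/G`. Assume that the
following conditions hold: the action `G ↷ V(𝒢)` is free; `𝒢` is quasi-transitive; `ℋ` is
quasi-transitive; `p_c(𝒢) < 1`. Then one has `p_c(𝒢) < p_c(ℋ)`." Standing conventions of the paper:
graphs non-empty, locally finite, connected, simple; Bernoulli bond percolation. Stated with the
tree's vertex-based `criticalProb` at an arbitrary vertex `x` and its orbit (for connected graphs
`p_c` is vertex-independent). Grounds
`Summit.CriticalPhenomena.PercolationContinuityZ3.Theses.PercDivergentSlabLadder.SlabStrictSubcritical`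
via `𝒢 = ℤ³`, `Γ = (2k+1)ℤ` translating the coordinate `z₀` (see the module docstring).
[cite: MartineauSevero2019, Cor. 2.2] -/
def MartineauSevero2019_cor22 : Prop :=
  ∀ (V : Type) [Countable V] (G : SimpleGraph V) [G.LocallyFinite] (Γ : Type) [Group Γ]
    [MulAction Γ V],
    Nontrivial Γ →
    (∀ (g : Γ) (x y : V), G.Adj (g • x) (g • y) ↔ G.Adj x y) →
    (∀ (g : Γ) (x : V), g • x = x → g = 1) →
    G.Connected → IsQuasiTransitive G → IsQuasiTransitive (orbitQuotientGraph G Γ) →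
    ∀ x : V, criticalProb G x < 1 →
      criticalProb G x < criticalProb (orbitQuotientGraph G Γ) (Quotient.mk (MulAction.orbitRel Γ V) x)

end Literature.Probability.Percolation
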